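import Literature.NumberTheory.Sieve.FejerKernelCounting
import Literature.NumberTheory.Sieve.VaughanMeanValueDecomposition
import Literature.Computability.Complexity.BooleanFourier
import Literature.Computability.Complexity.BoolEncodings
import Literature.NumberTheory.Sieve.MoebiusWalshCircuitsProofs
import HarnessLib

/-!
# From large Walsh coefficients to large Fourier coefficients at sparse dyadic rationals (Kátai; Green 2012, Proposition 2)

Topic `Literature/Computability/Complexity` (Fourier analysis on the cube versus on `ℤ/Nℤ`).
Everything in this file is PROVED; the two `def`s (`ψ`, `Φ`) are elementary
auxiliary objects with bodies.

B. Green, *On (not) computing the Möbius function using bounded depth circuits*, CPC 21 (2012)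
[Green2012], §3 ("An argument of Kátai"), Proposition 2:

> Let `f : {0,…,N−1} → [−1,1]` be a function for which there exists some `S ⊆ {1,…,n}`,
> `|S| = k`, for which the Fourier–Walsh coefficient `f̂(S)` has magnitude at least `δ`. Then
> there is a dyadic rational `θ` such that `f̂(θ) = E_{x<N} f(x)e(θx)` has magnitude at least
> `(δ/10k)^{4k}`; in fact `θ = r_1/2^{i_1} + ⋯ + r_k/2^{i_k}` with `|r_i| ≤ (10k/δ)^3`.

We prove the same statement with different (immaterial) dependencies: for every `R ≥ 1` with
`4k(n+1) ≤ δR` there is `θ = ∑_{i ∈ S} r_i/2^{i+1}`, `|r_i| < R`, with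
`|∑_{x<2^n} f(x)e(θx)| ≥ (δ/(2(2R)^k)) 2^n` (`exists_sparse_dyadic_of_le_abs_cubeFourierCoeff`).
Green smooths the square wave `ψ(x/2^i) = (−1)^{x_i}` by a double box convolution and truncates
its Fourier series; we smooth instead with the (discrete) Fejér kernel of the tree's
`FejerKernelCounting.lean`, which keeps every smoothed digit function bounded by `1`, is exact for
the low digits, and whose expansion in additive characters needs no Fourier inversion of `ψ`:
`T(m) = M⁻¹∑_z K(z/M)ψ(m+z) = ∑_{|h|<R} v_h e(hm/M)` with `|v_h| ≤ 1`. The `L¹` error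
`E|ψ − T| ≤ 2(1 + log M)/R` comes from `K(t) ≤ 1/(4R‖t‖²)` and
`#{y : ψ(y) ≠ ψ(y+z)} ≤ 2 min(z, M−z)`.

## References
* [Green2012] B. Green, CPC 21 (2012), §3 Proposition 2.
* I. Kátai, Acta Math. Hungar. 47 (1986) 341–359; G. Harman, I. Kátai, Acta Arith. 133 (2008).
-/

noncomputable section

open Finset Real
open scoped FourierTransform

namespace Literature.Computability.Complexity

namespace WalshDyadic

open Literature.NumberTheory.Sieve.FejerCounting (fejerKernel fejerKernel_nonneg fejerKernel_eq_sum
  fejerKernel_le_inv_sq fejerKernel_neg fejerKernel_add_intCast distInt_eq_self dirichletSum)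
open Literature.NumberTheory.Sieve.Vinogradov (distInt distInt_nonneg distInt_neg distInt_add_int
  norm_fourierChar)
open Literature.NumberTheory.Sieve.RamanujanSum (fourierChar_intCast sum_range_fourierChar_div)
open Literature.NumberTheory.Sieve.FejerCounting (fourierChar_add_intCast)

/-! ### The square wave of period `M` -/

/-- `|ψ| ≤ 1`. [folklore] -/
theorem abs_sq_le (ψ : ℕ → ℕ → ℝ) (hψ : ∀ M y, ψ M y = if y % M < M / 2 then (1 : ℝ) else -1) (M y : ℕ) :
    |ψ M y| ≤ 1 := by
  rw [hψ]; split_ifs <;> simp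

/-- `ψ` is `M`-periodic. [folklore] -/
theorem sq_add_period (ψ : ℕ → ℕ → ℝ) (hψ : ∀ M y, ψ M y = if y % M < M / 2 then (1 : ℝ) else -1) (M y : ℕ) :
    ψ M (y + M) = ψ M y := by
  rw [hψ, hψ, Nat.add_mod_right]

/-- **The digit function is a square wave**: `(−1)^{x_i} = ψ_{2^{i+1}}(x)`, i.e.
`ψ (2^(i+1)) m = sgn (m.testBit i)` with `sgn true = −1`. [cite: Green2012, §3 (11)] -/
theorem sq_two_pow_succ (ψ : ℕ → ℕ → ℝ) (hψ : ∀ M y, ψ M y = if y % M < M / 2 then (1 : ℝ) else -1) (i m : ℕ) :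
    ψ (2 ^ (i + 1)) m = Literature.Probability.RandomGraphs.LowDegree.sgn (m.testBit i) := by
  rw [hψ]
  unfold Literature.Probability.RandomGraphs.LowDegree.sgn
  have h2 : 2 ^ (i + 1) / 2 = 2 ^ i := by rw [pow_succ, Nat.mul_div_cancel _ two_pos]
  rw [h2, Nat.mod_pow_succ, Nat.testBit_eq_decide_div_mod_eq]
  have hlt : m % 2 ^ i < 2 ^ i := Nat.mod_lt _ (Nat.two_pow_pos i)
  rcases Nat.mod_two_eq_zero_or_one (m / 2 ^ i) with h0 | h1
  · rw [h0]; simp [hlt]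
  · rw [h1]; simp

/-! ### Sums of periodic functions -/

/-- Shift invariance of a full-period sum of an `M`-periodic sequence. [folklore] -/
theorem sum_range_add_of_periodic {β : Type*} [AddCommGroup β] {g : ℕ → β} {M : ℕ}
    (hg : ∀ y, g (y + M) = g y) (m : ℕ) :
    ∑ z ∈ range M, g (m + z) = ∑ z ∈ range M, g z := by
  induction m with
  | zero => simp
  | succ m ih =>
    have h1 : ∑ z ∈ range M, g (m + 1 + z) = ∑ z ∈ range M, g (m + (z + 1)) :=
      Finset.sum_congr rfl fun z _ => by rw [show m + 1 + z = m + (z + 1) by ring]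
    rw [h1]
    have h2 := Finset.sum_range_succ (fun z => g (m + z)) M
    have h3 := Finset.sum_range_succ' (fun z => g (m + z)) M
    rw [hg] at h2
    rw [add_zero] at h3
    -- `h2 : ∑_{z<M+1} g(m+z) = ∑_{z<M} g(m+z) + g m`, `h3 : ∑_{z<M+1} g(m+z) = ∑_{z<M} g(m+z+1) + g m`
    have : ∑ z ∈ range M, g (m + (z + 1)) = ∑ z ∈ range M, g (m + z) := by
      have := h2.symm.trans h3
      exact (add_right_cancel this).symm
    rw [this, ih]

/-- A sum over `c` periods is `c` times the sum over one period. [folklore] -/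
theorem sum_range_mul_of_periodic {g : ℕ → ℝ} {M : ℕ} (hg : ∀ y, g (y + M) = g y) (c : ℕ) :
    ∑ m ∈ range (M * c), g m = c * ∑ y ∈ range M, g y := by
  induction c with
  | zero => simp
  | succ c ih =>
    rw [Nat.mul_succ, Finset.sum_range_add, ih, sum_range_add_of_periodic hg]
    push_cast; ring

/-! ### The discrete Fejér smoothing of the square wave -/

/-- `T` is `M`-periodic. [folklore] -/
theorem smooth_add_period (ψ : ℕ → ℕ → ℝ) (hψ : ∀ M y, ψ M y = if y % M < M / 2 then (1 : ℝ) else -1)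
    (Φ : ℕ → ℕ → ℕ → ℝ)
    (hΦ : ∀ H M y, Φ H M y = (∑ z ∈ range M, fejerKernel H ((z : ℝ) / M) * ψ M (y + z)) / M) (H M y : ℕ) :
    Φ H M (y + M) = Φ H M y := by
  rw [hΦ, hΦ]
  congr 1
  refine Finset.sum_congr rfl fun z _ => ?_
  rw [show y + M + z = y + z + M by ring, sq_add_period ψ hψ]

/-- **Mass of the discrete Fejér kernel**: `∑_{z<M} K_H(z/M) = M` for `H + 1 ≤ M`
(expand `K_H(t) = R⁻¹∑_{n,n'≤R} e((n−n')t)` and use orthogonality on `ℤ/Mℤ`). [folklore] -/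
theorem sum_range_fejerKernel_div {H M : ℕ} (hHM : H + 1 ≤ M) :
    ∑ z ∈ range M, fejerKernel H ((z : ℝ) / M) = M := by
  have hM : M ≠ 0 := by omega
  have hC : (∑ z ∈ range M, (fejerKernel H ((z : ℝ) / M) : ℂ)) = (M : ℂ) := by
    simp_rw [fejerKernel_eq_sum]
    rw [← Finset.mul_sum, Finset.sum_comm]
    have hinner : ∀ n ∈ Ioc 0 (H + 1),
        ∑ z ∈ range M, ∑ n' ∈ Ioc 0 (H + 1), (𝐞 (((n : ℝ) - n') * ((z : ℝ) / M)) : ℂ) = M := by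
      intro n hn
      rw [Finset.sum_comm]
      have h1 : ∀ n' ∈ Ioc 0 (H + 1), ∑ z ∈ range M, (𝐞 (((n : ℝ) - n') * ((z : ℝ) / M)) : ℂ) =
          if n' = n then (M : ℂ) else 0 := by
        intro n' hn'
        have h2 : ∀ z ∈ range M, (𝐞 (((n : ℝ) - n') * ((z : ℝ) / M)) : ℂ) =
            𝐞 ((z : ℝ) * (((n : ℤ) - n' : ℤ) : ℝ) / M) := by
          intro z _; congr 1; push_cast; ring
        rw [Finset.sum_congr rfl h2, sum_range_fourierChar_div hM]
        have hn1 := (Finset.mem_Ioc.mp hn)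
        have hn'1 := (Finset.mem_Ioc.mp hn')
        by_cases hnn : n' = n
        · subst hnn; simp
        · rw [if_neg hnn, if_neg]
          intro hdvd
          have habs : |((n : ℤ) - n')| < M := by rw [abs_lt]; constructor <;> omega
          have hne : ((n : ℤ) - n') ≠ 0 := by omega
          have := Int.le_of_dvd (abs_pos.mpr hne) ((dvd_abs _ _).mpr hdvd)
          omega
      rw [Finset.sum_congr rfl h1, Finset.sum_ite_eq' (Ioc 0 (H + 1)) n, if_pos hn]
    rw [Finset.sum_congr rfl hinner, Finset.sum_const, Nat.card_Ioc, nsmul_eq_mul]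
    push_cast
    field_simp
  exact_mod_cast hC

/-- `|T| ≤ 1` (an average of values `±1` against nonnegative weights of total mass `M`).
[cite: Green2012, §3 (`ψ̃` takes values in `[−1,1]`)] -/
theorem abs_smooth_le (ψ : ℕ → ℕ → ℝ) (hψ : ∀ M y, ψ M y = if y % M < M / 2 then (1 : ℝ) else -1)
    (Φ : ℕ → ℕ → ℕ → ℝ)
    (hΦ : ∀ H M y, Φ H M y = (∑ z ∈ range M, fejerKernel H ((z : ℝ) / M) * ψ M (y + z)) / M) {H M : ℕ} (hHM : H + 1 ≤ M) (y : ℕ) :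
    |Φ H M y| ≤ 1 := by
  have hM0 : (0 : ℝ) < M := by exact_mod_cast (show 0 < M by omega)
  rw [hΦ]
  rw [abs_div, abs_of_pos hM0, div_le_one hM0]
  calc |∑ z ∈ range M, fejerKernel H ((z : ℝ) / M) * ψ M (y + z)|
      ≤ ∑ z ∈ range M, |fejerKernel H ((z : ℝ) / M) * ψ M (y + z)| := abs_sum_le_sum_abs _ _
    _ ≤ ∑ z ∈ range M, fejerKernel H ((z : ℝ) / M) := by
        refine Finset.sum_le_sum fun z _ => ?_
        rw [abs_mul, abs_of_nonneg (fejerKernel_nonneg H _)]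
        calc _ ≤ fejerKernel H ((z : ℝ) / M) * 1 :=
              mul_le_mul_of_nonneg_left (abs_sq_le ψ hψ M _) (fejerKernel_nonneg H _)
          _ = _ := mul_one _
    _ = M := sum_range_fejerKernel_div hHM

/-- **Exactness for a full-period kernel**: `K_{M−1}(z/M) = M·[M ∣ z]`, so the smoothing of
order `H = M − 1` is the identity: `T = ψ`. [folklore] -/
theorem smooth_eq_self (ψ : ℕ → ℕ → ℝ)
    (Φ : ℕ → ℕ → ℕ → ℝ)
    (hΦ : ∀ H M y, Φ H M y = (∑ z ∈ range M, fejerKernel H ((z : ℝ) / M) * ψ M (y + z)) / M) {M : ℕ} (hM : 1 ≤ M) (y : ℕ) :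
    Φ (M - 1) M y = ψ M y := by
  have hM0 : M ≠ 0 := by omega
  have hMr : (M : ℝ) ≠ 0 := by exact_mod_cast hM0
  -- the kernel at `z/M`
  have hker : ∀ z ∈ range M, fejerKernel (M - 1) ((z : ℝ) / M) = if z = 0 then (M : ℝ) else 0 := by
    intro z hz
    have hzM : z < M := Finset.mem_range.mp hz
    have hD : dirichletSum (M - 1) ((z : ℝ) / M) = if z = 0 then (M : ℂ) else 0 := by
      unfold dirichletSum
      rw [Nat.sub_add_cancel hM]
      -- `∑_{n=1}^{M} e(nz/M) = ∑_{a=0}^{M-1} e(az/M)` (the terms `n = M` and `a = 0` are both `1`)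
      have hshift : ∑ n ∈ Ioc 0 M, (𝐞 ((n : ℝ) * ((z : ℝ) / M)) : ℂ) =
          ∑ a ∈ range M, (𝐞 ((a : ℝ) * (z : ℤ) / M) : ℂ) := by
        have h1 : Ioc 0 M = insert M (Ioo 0 M) := by
          ext n; simp only [Finset.mem_Ioc, Finset.mem_insert, Finset.mem_Ioo]; omega
        have h2 : range M = insert 0 (Ioo 0 M) := by
          ext n; simp only [Finset.mem_range, Finset.mem_insert, Finset.mem_Ioo]; omega
        rw [h1, h2, Finset.sum_insert (by simp), Finset.sum_insert (by simp)]
        congr 1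
        · have : (M : ℝ) * ((z : ℝ) / M) = ((z : ℤ) : ℝ) := by push_cast; field_simp
          rw [this, fourierChar_intCast]
          simp
        · refine Finset.sum_congr rfl fun n _ => ?_
          congr 1; push_cast; ring
      rw [hshift, sum_range_fourierChar_div hM0]
      by_cases hz0 : z = 0
      · subst hz0; simp
      · rw [if_neg, if_neg hz0]
        intro hdvd
        have := Int.le_of_dvd (by exact_mod_cast Nat.pos_of_ne_zero hz0) hdvd
        omega
    unfold fejerKernel
    rw [hD]
    split_ifs with hz0
    · rw [Complex.norm_natCast, Nat.cast_sub hM, Nat.cast_one, sub_add_cancel, sq, mul_div_assoc,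
        div_self hMr, mul_one]
    · simp
  rw [hΦ]
  rw [Finset.sum_congr rfl fun z hz => by rw [hker z hz]]
  simp only [ite_mul, zero_mul, Finset.sum_ite_eq', Finset.mem_range]
  rw [if_pos (by omega), add_zero]
  field_simp

/-! ### The `L¹` error of the smoothing -/

/-- **Few sign changes under a shift**: for `z < M`, the residues `y < M` with `ψ(y) ≠ ψ(y + z)`
number at most `2 min(z, M − z)`. [cite: Green2012, §3 (proof of (12))] -/
theorem card_filter_sq_ne_le (ψ : ℕ → ℕ → ℝ) (hψ : ∀ M y, ψ M y = if y % M < M / 2 then (1 : ℝ) else -1) {M z : ℕ} (hz : z < M) :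
    (((range M).filter fun y => ψ M y ≠ ψ M (y + z)).card : ℝ) ≤ 2 * min z (M - z) := by
  set d : ℕ := min z (M - z) with hd
  set a : ℕ := M / 2 - z with ha
  set b : ℕ := max (M - z) (M / 2) with hb
  have hsub : (range M).filter (fun y => ψ M y ≠ ψ M (y + z)) ⊆ Ico a (a + d) ∪ Ico b (b + d) := by
    intro y hy
    rw [Finset.mem_filter, Finset.mem_range] at hy
    obtain ⟨hyM, hne⟩ := hy
    rw [Finset.mem_union, Finset.mem_Ico, Finset.mem_Ico]
    rw [hψ, hψ] at hne
    rw [Nat.mod_eq_of_lt hyM] at hne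
    by_cases hwrap : y + z < M
    · rw [Nat.mod_eq_of_lt hwrap] at hne
      left
      by_cases h1 : y < M / 2
      · by_cases h2 : y + z < M / 2
        · exfalso; rw [if_pos h1, if_pos h2] at hne; exact hne rfl
        · constructor <;> omega
      · by_cases h2 : y + z < M / 2
        · omega
        · exfalso; rw [if_neg h1, if_neg h2] at hne; exact hne rfl
    · have hmod : (y + z) % M = y + z - M := by
        rw [Nat.mod_eq_sub_mod (by omega), Nat.mod_eq_of_lt (by omega)]
      rw [hmod] at hne
      right
      by_cases h1 : y < M / 2
      · by_cases h2 : y + z - M < M / 2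
        · exfalso; rw [if_pos h1, if_pos h2] at hne; exact hne rfl
        · omega
      · by_cases h2 : y + z - M < M / 2
        · constructor <;> omega
        · exfalso; rw [if_neg h1, if_neg h2] at hne; exact hne rfl
  calc (((range M).filter fun y => ψ M y ≠ ψ M (y + z)).card : ℝ)
      ≤ ((Ico a (a + d) ∪ Ico b (b + d)).card : ℝ) := by exact_mod_cast Finset.card_le_card hsub
    _ ≤ ((Ico a (a + d)).card + (Ico b (b + d)).card : ℕ) := by
        exact_mod_cast Finset.card_union_le _ _
    _ = 2 * min z (M - z) := by
        rw [Nat.card_Ico, Nat.card_Ico, Nat.add_sub_cancel_left, Nat.add_sub_cancel_left, hd]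
        push_cast; ring

/-- `∑_{y<M} |ψ(y) − ψ(y+z)| ≤ 4 min(z, M − z)` for `z < M`. [cite: Green2012, §3 (proof of (12))] -/
theorem sum_abs_sq_sub_le (ψ : ℕ → ℕ → ℝ) (hψ : ∀ M y, ψ M y = if y % M < M / 2 then (1 : ℝ) else -1) {M z : ℕ} (hz : z < M) :
    ∑ y ∈ range M, |ψ M y - ψ M (y + z)| ≤ 4 * min z (M - z) := by
  have hpt : ∀ y ∈ range M, |ψ M y - ψ M (y + z)| ≤
      if ψ M y ≠ ψ M (y + z) then (2 : ℝ) else 0 := by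
    intro y _
    split_ifs with h
    · calc |ψ M y - ψ M (y + z)| ≤ |ψ M y| + |ψ M (y + z)| := abs_sub _ _
        _ ≤ 1 + 1 := add_le_add (abs_sq_le ψ hψ M y) (abs_sq_le ψ hψ M _)
        _ = 2 := by norm_num
    · push Not at h; rw [h, sub_self, abs_zero]
  refine (Finset.sum_le_sum hpt).trans ?_
  rw [Finset.sum_ite, Finset.sum_const_zero, add_zero, Finset.sum_const, nsmul_eq_mul]
  have := card_filter_sq_ne_le ψ hψ hz
  linarith

/-- The distance from `z/M` to the nearest integer is `min(z, M − z)/M` (`z ≤ M`, `M > 0`).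
[folklore] -/
theorem distInt_natCast_div {M z : ℕ} (hM : 0 < M) (hz : z ≤ M) :
    distInt ((z : ℝ) / M) = (min z (M - z) : ℕ) / M := by
  have hMr : (0 : ℝ) < M := by exact_mod_cast hM
  rcases le_or_gt (2 * z) M with h2 | h2
  · have hmin : min z (M - z) = z := min_eq_left (by omega)
    rw [hmin]
    refine distInt_eq_self (by positivity) ?_
    rw [div_le_iff₀ hMr]
    have : (2 : ℝ) * z ≤ M := by exact_mod_cast h2
    linarith
  · have hmin : min z (M - z) = M - z := min_eq_right (by omega)
    rw [hmin]
    have h1 : (z : ℝ) / M = -(((M - z : ℕ) : ℝ) / M) + ((1 : ℤ) : ℝ) := by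
      rw [Nat.cast_sub hz]; push_cast; field_simp; ring
    rw [h1, distInt_add_int, distInt_neg]
    refine distInt_eq_self (by positivity) ?_
    rw [div_le_iff₀ hMr, Nat.cast_sub hz]
    have : (M : ℝ) < 2 * z := by exact_mod_cast h2
    linarith

/-- **The Fejér kernel at `z/M`**: for `0 < z < M`,
`K_H(z/M) ≤ M²/(4(H+1) min(z, M−z)²)`. [folklore] -/
theorem fejerKernel_natCast_div_le (H : ℕ) {M z : ℕ} (hz0 : 0 < z) (hz : z < M) :
    fejerKernel H ((z : ℝ) / M) ≤ (M : ℝ) ^ 2 / (4 * (H + 1) * ((min z (M - z) : ℕ) : ℝ) ^ 2) := by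
  have hM : 0 < M := by omega
  have hMr : (0 : ℝ) < M := by exact_mod_cast hM
  have hd : 0 < min z (M - z) := by apply lt_min hz0; omega
  have hdr : (0 : ℝ) < ((min z (M - z) : ℕ) : ℝ) := by exact_mod_cast hd
  have hdist : distInt ((z : ℝ) / M) = (min z (M - z) : ℕ) / M := distInt_natCast_div hM hz.le
  have hpos : 0 < distInt ((z : ℝ) / M) := by rw [hdist]; positivity
  refine (fejerKernel_le_inv_sq H hpos).trans (le_of_eq ?_)
  rw [hdist]
  field_simp

/-- `∑_{0<z<M} 1/(M − z) = ∑_{0<z<M} 1/z` (reflection). [folklore] -/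
theorem sum_Ioo_inv_sub_eq (M : ℕ) :
    ∑ z ∈ Ioo 0 M, (((M - z : ℕ) : ℝ))⁻¹ = ∑ z ∈ Ioo 0 M, ((z : ℝ))⁻¹ := by
  refine Finset.sum_nbij' (fun z => M - z) (fun z => M - z) ?_ ?_ ?_ ?_ ?_
  · intro z hz; simp only [Finset.mem_Ioo] at hz ⊢; omega
  · intro z hz; simp only [Finset.mem_Ioo] at hz ⊢; omega
  · intro z hz; simp only [Finset.mem_Ioo] at hz; omega
  · intro z hz; simp only [Finset.mem_Ioo] at hz; omega
  · intro z _; rfl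

/-- `∑_{0<z<M} 1/min(z, M−z) ≤ 2(1 + log M)`. [folklore] -/
theorem sum_Ioo_inv_min_le (M : ℕ) :
    ∑ z ∈ Ioo 0 M, (((min z (M - z) : ℕ) : ℝ))⁻¹ ≤ 2 * (1 + Real.log M) := by
  have hpt : ∀ z ∈ Ioo 0 M, (((min z (M - z) : ℕ) : ℝ))⁻¹ ≤ ((z : ℝ))⁻¹ + (((M - z : ℕ) : ℝ))⁻¹ := by
    intro z hz
    rw [Finset.mem_Ioo] at hz
    have hz0 : (0 : ℝ) < z := by exact_mod_cast hz.1
    have hMz : (0 : ℝ) < ((M - z : ℕ) : ℝ) := by exact_mod_cast (show 0 < M - z by omega)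
    rcases le_total z (M - z) with h | h
    · rw [min_eq_left h]
      have := inv_pos.2 hMz
      linarith
    · rw [min_eq_right h]
      have := inv_pos.2 hz0
      linarith
  refine (Finset.sum_le_sum hpt).trans ?_
  rw [Finset.sum_add_distrib, sum_Ioo_inv_sub_eq, ← two_mul]
  refine mul_le_mul_of_nonneg_left ?_ (by norm_num)
  calc ∑ z ∈ Ioo 0 M, ((z : ℝ))⁻¹ ≤ ∑ z ∈ Ioc 0 M, ((z : ℝ))⁻¹ :=
        Finset.sum_le_sum_of_subset_of_nonneg (fun z hz => by
          simp only [Finset.mem_Ioo, Finset.mem_Ioc] at hz ⊢; omega) fun _ _ _ => by positivity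
    _ ≤ 1 + Real.log M := Literature.NumberTheory.Sieve.Vaughan.sum_Ioc_inv_le M

/-- **`L¹` error of the Fejér smoothing of the square wave**: for `H + 1 ≤ M`,
`∑_{y<M} |ψ(y) − T(y)| ≤ 2M(1 + log M)/(H+1)`, i.e. `E|ψ − T| ≤ 2(1 + log M)/R`
(Green's property (12), `E|ψ − ψ̃| ≤ ε`, for his smoothing). [cite: Green2012, §3 (12)] -/
theorem sum_abs_sq_sub_smooth_le (ψ : ℕ → ℕ → ℝ) (hψ : ∀ M y, ψ M y = if y % M < M / 2 then (1 : ℝ) else -1)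
    (Φ : ℕ → ℕ → ℕ → ℝ)
    (hΦ : ∀ H M y, Φ H M y = (∑ z ∈ range M, fejerKernel H ((z : ℝ) / M) * ψ M (y + z)) / M) {H M : ℕ} (hHM : H + 1 ≤ M) :
    ∑ y ∈ range M, |ψ M y - Φ H M y| ≤
      2 * M * (1 + Real.log M) / (H + 1) := by
  have hM : 0 < M := by omega
  have hMr : (0 : ℝ) < M := by exact_mod_cast hM
  have hR : (0 : ℝ) < H + 1 := by positivity
  set F : ℕ → ℝ := fun z => fejerKernel H ((z : ℝ) / M) with hFdef
  have hF0 : ∀ z, 0 ≤ F z := fun z => fejerKernel_nonneg H _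
  have hmass : ∑ z ∈ range M, F z = M := sum_range_fejerKernel_div hHM
  -- `ψ(y) − T(y) = M⁻¹ ∑_z F_z (ψ(y) − ψ(y+z))`
  have hdiff : ∀ y, ψ M y - Φ H M y =
      (∑ z ∈ range M, F z * (ψ M y - ψ M (y + z))) / M := by
    intro y
    rw [hΦ, eq_div_iff hMr.ne', sub_mul, div_mul_cancel₀ _ hMr.ne']
    simp only [mul_sub, Finset.sum_sub_distrib, ← Finset.sum_mul]
    rw [hmass, mul_comm]
  have hpt : ∀ y ∈ range M, |ψ M y - Φ H M y| ≤
      (∑ z ∈ range M, F z * |ψ M y - ψ M (y + z)|) / M := by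
    intro y _
    rw [hdiff, abs_div, abs_of_pos hMr]
    refine div_le_div_of_nonneg_right ((abs_sum_le_sum_abs _ _).trans (le_of_eq ?_)) hMr.le
    refine Finset.sum_congr rfl fun z _ => ?_
    rw [abs_mul, abs_of_nonneg (hF0 z)]
  refine (Finset.sum_le_sum hpt).trans ?_
  rw [← Finset.sum_div, Finset.sum_comm]
  -- now `∑_z F_z ∑_y |ψ(y) − ψ(y+z)| ≤ ∑_{0<z<M} M²/(R d_z)`
  have hz : ∀ z ∈ range M, ∑ y ∈ range M, F z * |ψ M y - ψ M (y + z)| ≤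
      if 0 < z then (M : ℝ) ^ 2 / ((H + 1) * ((min z (M - z) : ℕ) : ℝ)) else 0 := by
    intro z hzM
    rw [Finset.mem_range] at hzM
    rw [← Finset.mul_sum]
    split_ifs with hz0'
    swap
    · have hz0 : z = 0 := by omega
      subst hz0
      simp
    · have hd : 0 < min z (M - z) := by apply lt_min hz0'; omega
      have hdr : (0 : ℝ) < ((min z (M - z) : ℕ) : ℝ) := by exact_mod_cast hd
      calc F z * ∑ y ∈ range M, |ψ M y - ψ M (y + z)|
          ≤ (M : ℝ) ^ 2 / (4 * (H + 1) * ((min z (M - z) : ℕ) : ℝ) ^ 2) * (4 * min z (M - z)) :=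
            mul_le_mul (fejerKernel_natCast_div_le H hz0' hzM) (sum_abs_sq_sub_le ψ hψ hzM)
              (Finset.sum_nonneg fun _ _ => abs_nonneg _) (by positivity)
        _ = (M : ℝ) ^ 2 / ((H + 1) * ((min z (M - z) : ℕ) : ℝ)) := by
            push_cast
            field_simp
  refine (div_le_div_of_nonneg_right (Finset.sum_le_sum hz) hMr.le).trans ?_
  rw [← Finset.sum_filter]
  have hfilter : (range M).filter (fun z => 0 < z) = Ioo 0 M := by
    ext z; simp only [Finset.mem_filter, Finset.mem_range, Finset.mem_Ioo]; omega
  rw [hfilter]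
  have hsum : ∑ z ∈ Ioo 0 M, (M : ℝ) ^ 2 / ((H + 1) * ((min z (M - z) : ℕ) : ℝ)) =
      (M : ℝ) ^ 2 / (H + 1) * ∑ z ∈ Ioo 0 M, (((min z (M - z) : ℕ) : ℝ))⁻¹ := by
    rw [Finset.mul_sum]
    refine Finset.sum_congr rfl fun z _ => ?_
    rw [← div_div, div_eq_mul_inv]
  rw [hsum]
  have hinv := sum_Ioo_inv_min_le M
  calc ((M : ℝ) ^ 2 / (H + 1) * ∑ z ∈ Ioo 0 M, (((min z (M - z) : ℕ) : ℝ))⁻¹) / M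
      ≤ ((M : ℝ) ^ 2 / (H + 1) * (2 * (1 + Real.log M))) / M := by
        refine div_le_div_of_nonneg_right (mul_le_mul_of_nonneg_left hinv (by positivity)) hMr.le
    _ = 2 * M * (1 + Real.log M) / (H + 1) := by
        field_simp

/-! ### The smoothed square wave is a short trigonometric polynomial -/

/-- The number of pairs `(n, n') ∈ [1, R]²` with `n' − n = h` is at most `R`. [folklore] -/
theorem card_filter_sub_eq_le (R : ℕ) (h : ℤ) :
    ((Ioc 0 R ×ˢ Ioc 0 R).filter (fun p : ℕ × ℕ => (p.2 : ℤ) - p.1 = h)).card ≤ R := by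
  calc ((Ioc 0 R ×ˢ Ioc 0 R).filter (fun p : ℕ × ℕ => (p.2 : ℤ) - p.1 = h)).card
      ≤ (Ioc 0 R).card := by
        refine Finset.card_le_card_of_injOn (fun p => p.1) ?_ ?_
        · intro p hp
          simp only [Finset.coe_filter, Set.mem_setOf_eq, Finset.mem_product] at hp
          exact hp.1.1
        · intro p hp p' hp' hpp
          simp only [Finset.coe_filter, Set.mem_setOf_eq, Finset.mem_product] at hp hp'
          have h2 : (p.2 : ℤ) = p'.2 := by
            have := hp.2; have := hp'.2
            simp only at hpp
            omega
          exact Prod.ext hpp (by exact_mod_cast h2)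
    _ = R := by simp

/-- **The smoothed square wave as a trigonometric polynomial of length `< R`**: there are
coefficients `v_h`, `|v_h| ≤ 1`, with `T(m) = ∑_{|h| < R} v_h e(hm/M)` for all `m`
(`R = H + 1`; expand `K_H(z/M) = R⁻¹∑_{n,n'} e((n−n')z/M)` and use the shift invariance of full
period sums: `∑_{z<M} e((n−n')z/M)ψ(m+z) = e((n'−n)m/M) ∑_{y<M} e((n−n')y/M)ψ(y)`).
[cite: Green2012, §3 (13) (the shape of `ψ̃`)] -/
theorem smooth_eq_trigPoly (ψ : ℕ → ℕ → ℝ) (hψ : ∀ M y, ψ M y = if y % M < M / 2 then (1 : ℝ) else -1)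
    (Φ : ℕ → ℕ → ℕ → ℝ)
    (hΦ : ∀ H M y, Φ H M y = (∑ z ∈ range M, fejerKernel H ((z : ℝ) / M) * ψ M (y + z)) / M) (H M : ℕ) (hM : 0 < M) :
    ∃ v : ℤ → ℂ, (∀ h, ‖v h‖ ≤ 1) ∧ ∀ m : ℕ, (Φ H M m : ℂ) =
      ∑ h ∈ Ioo (-((H : ℤ) + 1)) ((H : ℤ) + 1), v h * 𝐞 ((m : ℝ) * ((h : ℝ) / M)) := by
  have hMr : (M : ℝ) ≠ 0 := by exact_mod_cast hM.ne'
  have hMc : (M : ℂ) ≠ 0 := by exact_mod_cast hM.ne'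
  have hR : ((H : ℂ) + 1) ≠ 0 := by exact_mod_cast (Nat.succ_ne_zero H)
  -- the coefficients `A_{n,n'}` and their aggregates `v_h`
  set A : ℕ × ℕ → ℂ := fun p => ((H : ℂ) + 1)⁻¹ * (M : ℂ)⁻¹ *
    ∑ y ∈ range M, (𝐞 ((((p.1 : ℝ) - p.2)) * ((y : ℝ) / M)) : ℂ) * (ψ M y : ℂ) with hAdef
  set P : Finset (ℕ × ℕ) := Ioc 0 (H + 1) ×ˢ Ioc 0 (H + 1) with hPdef
  set v : ℤ → ℂ := fun h => ∑ p ∈ P.filter (fun p : ℕ × ℕ => (p.2 : ℤ) - p.1 = h), A p with hvdef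
  have hA : ∀ p, ‖A p‖ ≤ ((H : ℝ) + 1)⁻¹ := by
    intro p
    rw [hAdef]
    simp only
    rw [norm_mul, norm_mul, norm_inv, norm_inv]
    have h1 : ‖((H : ℂ) + 1)‖ = (H : ℝ) + 1 := by
      rw [show ((H : ℂ) + 1) = ((H + 1 : ℕ) : ℂ) by push_cast; ring, Complex.norm_natCast]; push_cast; ring
    rw [h1, Complex.norm_natCast]
    have h2 : ‖∑ y ∈ range M, (𝐞 (((p.1 : ℝ) - p.2) * ((y : ℝ) / M)) : ℂ) * (ψ M y : ℂ)‖ ≤ M := by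
      calc _ ≤ ∑ y ∈ range M, ‖(𝐞 (((p.1 : ℝ) - p.2) * ((y : ℝ) / M)) : ℂ) * (ψ M y : ℂ)‖ :=
            norm_sum_le _ _
        _ ≤ ∑ y ∈ range M, (1 : ℝ) := by
            refine Finset.sum_le_sum fun y _ => ?_
            rw [norm_mul, norm_fourierChar, one_mul, Complex.norm_real, Real.norm_eq_abs]
            exact abs_sq_le ψ hψ M y
        _ = M := by simp
    have hMpos : (0 : ℝ) < M := by exact_mod_cast hM
    calc ((H : ℝ) + 1)⁻¹ * (M : ℝ)⁻¹ * ‖∑ y ∈ range M, (𝐞 (((p.1 : ℝ) - p.2) * ((y : ℝ) / M)) : ℂ) *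
          (ψ M y : ℂ)‖ ≤ ((H : ℝ) + 1)⁻¹ * (M : ℝ)⁻¹ * M := by
          refine mul_le_mul_of_nonneg_left h2 (by positivity)
      _ = ((H : ℝ) + 1)⁻¹ := by field_simp
  refine ⟨v, fun h => ?_, fun m => ?_⟩
  · -- `‖v_h‖ ≤ #fiber · R⁻¹ ≤ 1`
    rw [hvdef]
    calc ‖∑ p ∈ P.filter (fun p : ℕ × ℕ => (p.2 : ℤ) - p.1 = h), A p‖
        ≤ ∑ p ∈ P.filter (fun p : ℕ × ℕ => (p.2 : ℤ) - p.1 = h), ‖A p‖ := norm_sum_le _ _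
      _ ≤ ∑ _p ∈ P.filter (fun p : ℕ × ℕ => (p.2 : ℤ) - p.1 = h), ((H : ℝ) + 1)⁻¹ :=
          Finset.sum_le_sum fun p _ => hA p
      _ = ((P.filter (fun p : ℕ × ℕ => (p.2 : ℤ) - p.1 = h)).card : ℝ) * ((H : ℝ) + 1)⁻¹ := by
          rw [Finset.sum_const, nsmul_eq_mul]
      _ ≤ (H + 1 : ℕ) * ((H : ℝ) + 1)⁻¹ := by
          refine mul_le_mul_of_nonneg_right ?_ (by positivity)
          exact_mod_cast card_filter_sub_eq_le (H + 1) h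
      _ = 1 := by push_cast; field_simp
  · -- the expansion
    have hstep1 : (Φ H M m : ℂ) =
        ∑ p ∈ P, A p * 𝐞 ((m : ℝ) * ((((p.2 : ℤ) - p.1 : ℤ) : ℝ) / M)) := by
      rw [hΦ]
      push_cast
      simp_rw [fejerKernel_eq_sum]
      rw [hPdef, Finset.sum_product, Finset.sum_div]
      have hz : ∀ z ∈ range M, ((H : ℂ) + 1)⁻¹ *
          (∑ n ∈ Ioc 0 (H + 1), ∑ n' ∈ Ioc 0 (H + 1), (𝐞 (((n : ℝ) - n') * ((z : ℝ) / M)) : ℂ)) *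
            (ψ M (m + z) : ℂ) / (M : ℂ) =
          ∑ n ∈ Ioc 0 (H + 1), ∑ n' ∈ Ioc 0 (H + 1), ((H : ℂ) + 1)⁻¹ * (M : ℂ)⁻¹ *
            ((𝐞 (((n : ℝ) - n') * ((z : ℝ) / M)) : ℂ) * (ψ M (m + z) : ℂ)) := by
        intro z _
        rw [div_eq_mul_inv, Finset.mul_sum, Finset.sum_mul, Finset.sum_mul]
        refine Finset.sum_congr rfl fun n _ => ?_
        rw [Finset.mul_sum, Finset.sum_mul, Finset.sum_mul]
        refine Finset.sum_congr rfl fun n' _ => ?_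
        ring
      rw [Finset.sum_congr rfl hz, Finset.sum_comm]
      refine Finset.sum_congr rfl fun n _ => ?_
      rw [Finset.sum_comm]
      refine Finset.sum_congr rfl fun n' _ => ?_
      -- shift invariance: `∑_z e((n−n')z/M) ψ(m+z) = e((n'−n)m/M) ∑_y e((n−n')y/M) ψ(y)`
      have hper : ∀ y : ℕ, (𝐞 (((n : ℝ) - n') * (((y + M : ℕ) : ℝ) / M)) : ℂ) * (ψ M (y + M) : ℂ) =
          (𝐞 (((n : ℝ) - n') * ((y : ℝ) / M)) : ℂ) * (ψ M y : ℂ) := by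
        intro y
        rw [sq_add_period ψ hψ]
        congr 1
        have hM1 : ((y + M : ℕ) : ℝ) / M = (y : ℝ) / M + 1 := by
          push_cast; rw [add_div, div_self hMr]
        have : ((n : ℝ) - n') * (((y + M : ℕ) : ℝ) / M) =
            ((n : ℝ) - n') * ((y : ℝ) / M) + (((n : ℤ) - n' : ℤ) : ℝ) := by
          rw [hM1]; push_cast; ring
        rw [this, fourierChar_add_intCast]
      have hshift := sum_range_add_of_periodic
        (g := fun y : ℕ => (𝐞 (((n : ℝ) - n') * ((y : ℝ) / M)) : ℂ) * (ψ M y : ℂ)) hper m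
      rw [← Finset.mul_sum]
      simp only [hAdef]
      rw [mul_assoc (((H : ℂ) + 1)⁻¹ * (M : ℂ)⁻¹)]
      congr 1
      rw [← hshift, Finset.sum_mul]
      refine Finset.sum_congr rfl fun z _ => ?_
      have key : (𝐞 (((n : ℝ) - n') * (((m + z : ℕ) : ℝ) / M)) : ℂ) *
          𝐞 ((m : ℝ) * (((n' : ℝ) - n) / M)) = 𝐞 (((n : ℝ) - n') * ((z : ℝ) / M)) := by
        rw [← Circle.coe_mul, ← AddChar.map_add_eq_mul]
        congr 2
        push_cast
        field_simp
        ring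
      calc (𝐞 (((n : ℝ) - n') * ((z : ℝ) / M)) : ℂ) * (ψ M (m + z) : ℂ)
          = (𝐞 (((n : ℝ) - n') * (((m + z : ℕ) : ℝ) / M)) : ℂ) *
              𝐞 ((m : ℝ) * (((n' : ℝ) - n) / M)) * (ψ M (m + z) : ℂ) := by rw [key]
        _ = _ := by ring
    rw [hstep1, hvdef]
    rw [← Finset.sum_fiberwise_of_maps_to (g := fun p : ℕ × ℕ => (p.2 : ℤ) - p.1)
      (t := Ioo (-((H : ℤ) + 1)) ((H : ℤ) + 1)) ?_]
    · refine Finset.sum_congr rfl fun h _ => ?_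
      rw [Finset.sum_mul]
      refine Finset.sum_congr rfl fun p hp => ?_
      rw [Finset.mem_filter] at hp
      rw [hp.2]
    · intro p hp
      rw [hPdef, Finset.mem_product, Finset.mem_Ioc, Finset.mem_Ioc] at hp
      rw [Finset.mem_Ioo]
      constructor <;> omega

/-! ### From the cube `{0,1}^n` to `{0, …, 2^n − 1}` -/

/-- **The Walsh sum over the cube is a sum over `{0,…,2^n−1}`** against the digit square waves:
`∑_x F(val x) χ_S(x) = ∑_{m<2^n} F(m) ∏_{i∈S} (−1)^{m_i}`. [cite: Green2012, §1 (Definition) and §3 (11)] -/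
theorem sum_cube_walsh_eq_sum_range (ψ : ℕ → ℕ → ℝ) (hψ : ∀ M y, ψ M y = if y % M < M / 2 then (1 : ℝ) else -1) {n : ℕ} (F : ℕ → ℝ)
    (S : Finset (Fin n)) :
    ∑ x : Fin n → Bool, F (bitsToNat (List.ofFn x)) *
        Literature.Probability.RandomGraphs.LowDegree.walsh S x =
      ∑ m ∈ range (2 ^ n), F m * ∏ i ∈ S, ψ (2 ^ ((i : ℕ) + 1)) m := by
  rw [Literature.NumberTheory.Sieve.MoebiusWalsh.sum_range_two_pow_eq_sum_cube]
  refine Finset.sum_congr rfl fun x _ => ?_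
  congr 1
  unfold Literature.Probability.RandomGraphs.LowDegree.walsh
  refine Finset.prod_congr rfl fun i _ => ?_
  rw [sq_two_pow_succ ψ hψ, Literature.NumberTheory.Sieve.MoebiusWalsh.testBit_bitsToNat_ofFn]

/-! ### Products of bounded factors -/

/-- **Telescoping**: if `|a_i|, |b_i| ≤ 1` then `|∏ a_i − ∏ b_i| ≤ ∑ |a_i − b_i|`. [folklore] -/
theorem abs_prod_sub_prod_le {ι : Type*} [DecidableEq ι] (s : Finset ι) (a b : ι → ℝ)
    (ha : ∀ i ∈ s, |a i| ≤ 1) (hb : ∀ i ∈ s, |b i| ≤ 1) :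
    |∏ i ∈ s, a i - ∏ i ∈ s, b i| ≤ ∑ i ∈ s, |a i - b i| := by
  induction s using Finset.induction_on with
  | empty => simp
  | insert j s hj ih =>
    rw [Finset.prod_insert hj, Finset.prod_insert hj, Finset.sum_insert hj]
    have ha' : ∀ i ∈ s, |a i| ≤ 1 := fun i hi => ha i (Finset.mem_insert_of_mem hi)
    have hb' : ∀ i ∈ s, |b i| ≤ 1 := fun i hi => hb i (Finset.mem_insert_of_mem hi)
    have hpb : |∏ i ∈ s, b i| ≤ 1 := by
      rw [Finset.abs_prod]
      exact Finset.prod_le_one (fun i _ => abs_nonneg _) hb'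
    have e : a j * ∏ i ∈ s, a i - b j * ∏ i ∈ s, b i =
        a j * (∏ i ∈ s, a i - ∏ i ∈ s, b i) + (a j - b j) * ∏ i ∈ s, b i := by ring
    rw [e]
    calc |a j * (∏ i ∈ s, a i - ∏ i ∈ s, b i) + (a j - b j) * ∏ i ∈ s, b i|
        ≤ |a j * (∏ i ∈ s, a i - ∏ i ∈ s, b i)| + |(a j - b j) * ∏ i ∈ s, b i| := abs_add_le _ _
      _ = |a j| * |∏ i ∈ s, a i - ∏ i ∈ s, b i| + |a j - b j| * |∏ i ∈ s, b i| := by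
          rw [abs_mul, abs_mul]
      _ ≤ 1 * (∑ i ∈ s, |a i - b i|) + |a j - b j| * 1 := by
          refine add_le_add (mul_le_mul (ha j (Finset.mem_insert_self j s)) (ih ha' hb')
            (abs_nonneg _) zero_le_one) (mul_le_mul_of_nonneg_left hpb (abs_nonneg _))
      _ = |a j - b j| + ∑ i ∈ s, |a i - b i| := by ring

/-! ### The smoothing parameters for the digit `i` -/

/-- The per-digit data: for `R ≥ 1` and a digit position `i < n` (modulus `M = 2^{i+1}`, Fejér
order `H = min(R, M) − 1`), the smoothed digit function `T` satisfies `|T| ≤ 1`,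
`∑_{m<2^n} |ψ(m) − T(m)| ≤ 2^n · 2(n+1)/R`, and `T(m) = ∑_{|h|<R} v_h e(mh/2^{i+1})` with
`|v_h| ≤ 1`. [cite: Green2012, §3 (12)–(13)] -/
theorem digit_smoothing_data (ψ : ℕ → ℕ → ℝ) (hψ : ∀ M y, ψ M y = if y % M < M / 2 then (1 : ℝ) else -1)
    (Φ : ℕ → ℕ → ℕ → ℝ)
    (hΦ : ∀ H M y, Φ H M y = (∑ z ∈ range M, fejerKernel H ((z : ℝ) / M) * ψ M (y + z)) / M) {n : ℕ} (i : Fin n) {R : ℕ} (hR : 1 ≤ R) :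
    ∃ T : ℕ → ℝ, ∃ v : ℤ → ℂ, (∀ m, |T m| ≤ 1) ∧ (∀ h, ‖v h‖ ≤ 1) ∧
      (∑ m ∈ range (2 ^ n), |ψ (2 ^ ((i : ℕ) + 1)) m - T m| ≤ 2 ^ n * (2 * (n + 1) / R)) ∧
      ∀ m : ℕ, (T m : ℂ) = ∑ h ∈ Ioo (-(R : ℤ)) R,
        v h * 𝐞 ((m : ℝ) * ((h : ℝ) / (2 : ℝ) ^ ((i : ℕ) + 1))) := by
  set M : ℕ := 2 ^ ((i : ℕ) + 1) with hMdef
  have hM1 : 1 ≤ M := Nat.one_le_two_pow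
  have hM0 : 0 < M := hM1
  set H : ℕ := min R M - 1 with hHdef
  have hH1 : H + 1 = min R M := by
    rw [hHdef]; have : 1 ≤ min R M := le_min hR hM1; omega
  have hHM : H + 1 ≤ M := by rw [hH1]; exact min_le_right _ _
  have hHR : H + 1 ≤ R := by rw [hH1]; exact min_le_left _ _
  obtain ⟨v, hv1, hv2⟩ := smooth_eq_trigPoly ψ hψ Φ hΦ H M hM0
  have hRr : (0 : ℝ) < R := by exact_mod_cast hR
  have hNr : (0 : ℝ) < (2 : ℝ) ^ n := by positivity
  -- pad `v` to the window `(−R, R)`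
  set v' : ℤ → ℂ := fun h => if h ∈ Ioo (-((H : ℤ) + 1)) ((H : ℤ) + 1) then v h else 0 with hv'def
  refine ⟨fun m => Φ H M m, v', fun m => abs_smooth_le ψ hψ Φ hΦ hHM m, fun h => ?_, ?_, fun m => ?_⟩
  · simp only [hv'def]; split_ifs
    · exact hv1 h
    · simp
  · -- the `L¹` error over the full range
    have hper : ∀ y, (fun y => |ψ M y - Φ H M y|) (y + M) =
        (fun y => |ψ M y - Φ H M y|) y := by
      intro y; simp only; rw [sq_add_period ψ hψ, smooth_add_period ψ hψ Φ hΦ]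
    have hNM : 2 ^ n = M * 2 ^ (n - ((i : ℕ) + 1)) := by
      rw [hMdef, ← pow_add]; congr 1; have := i.2; omega
    rw [hNM, sum_range_mul_of_periodic hper]
    -- one period
    have hperiod : ∑ y ∈ range M, |ψ M y - Φ H M y| ≤ M * (2 * (n + 1) / R) := by
      rcases le_or_gt R M with hRM | hRM
      · -- `H + 1 = R`
        have hHR' : H + 1 = R := by rw [hH1, min_eq_left hRM]
        have h1 := sum_abs_sq_sub_smooth_le ψ hψ Φ hΦ hHM
        have hcast : ((H : ℝ) + 1) = R := by exact_mod_cast hHR'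
        rw [hcast] at h1
        refine h1.trans ?_
        have hlogM : Real.log M ≤ n := by
          rw [hMdef]; push_cast
          rw [Real.log_pow]
          have hl2 : Real.log 2 ≤ 1 := by
            have := Real.log_two_lt_d9; linarith
          have hi : (((i : ℕ) + 1 : ℕ) : ℝ) ≤ n := by exact_mod_cast i.2
          calc (((i : ℕ) + 1 : ℕ) : ℝ) * Real.log 2 ≤ (((i : ℕ) + 1 : ℕ) : ℝ) * 1 :=
                mul_le_mul_of_nonneg_left hl2 (by positivity)
            _ ≤ n := by linarith
        have hM0r : (0 : ℝ) ≤ M := by positivity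
        rw [mul_div_assoc']
        refine div_le_div_of_nonneg_right ?_ hRr.le
        nlinarith
      · -- `H + 1 = M`: the smoothing is exact
        have hHM' : H = M - 1 := by rw [hHdef, min_eq_right hRM.le]
        have h0 : ∑ y ∈ range M, |ψ M y - Φ H M y| = 0 := by
          refine Finset.sum_eq_zero fun y _ => ?_
          rw [hHM', smooth_eq_self ψ Φ hΦ hM1, sub_self, abs_zero]
        rw [h0]; positivity
    calc ((2 ^ (n - ((i : ℕ) + 1)) : ℕ) : ℝ) * ∑ y ∈ range M, |ψ M y - Φ H M y|
        ≤ ((2 ^ (n - ((i : ℕ) + 1)) : ℕ) : ℝ) * (M * (2 * (n + 1) / R)) :=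
          mul_le_mul_of_nonneg_left hperiod (by positivity)
      _ = ((M * 2 ^ (n - ((i : ℕ) + 1)) : ℕ) : ℝ) * (2 * (n + 1) / R) := by push_cast; ring
      _ = 2 ^ n * (2 * (n + 1) / R) := by rw [← hNM]; push_cast; ring
  · -- the expansion, padded
    rw [hv2 m]
    have hsub : Ioo (-((H : ℤ) + 1)) ((H : ℤ) + 1) ⊆ Ioo (-(R : ℤ)) R := by
      intro h hh
      rw [Finset.mem_Ioo] at hh ⊢
      constructor <;> omega
    rw [← Finset.sum_subset hsub]
    · refine Finset.sum_congr rfl fun h hh => ?_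
      rw [hv'def]
      simp only
      rw [if_pos hh, hMdef]
      push_cast
      ring_nf
    · intro h _ hh
      rw [hv'def]
      simp only
      rw [if_neg hh, zero_mul]

/-! ### Green's Proposition 2 -/

/-- **Green 2012, Proposition 2 (Kátai's argument)**: let `f : ℕ → [−1, 1]`, `S ⊆ {0,…,n−1}`
with `|S| = k`, and suppose the Walsh coefficient
`f̂(S) = 2^{−n} ∑_{x ∈ {0,1}^n} f(val x) ∏_{i∈S}(−1)^{x_i}` has `|f̂(S)| ≥ δ > 0`. Then for every
`R ≥ 1` with `4k(n+1) ≤ δR` there are integers `r_i`, `|r_i| < R`, `r_i = 0` for `i ∉ S`, such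
that the sparse dyadic rational `θ = ∑_{i∈S} r_i/2^{i+1}` satisfies
`|∑_{m<2^n} f(m) e(mθ)| ≥ (δ / (2(2R)^k)) 2^n`. (Green: `|f̂(θ)| ≥ (δ/10k)^{4k}` with
`|r_i| ≤ (10k/δ)^3`; the dependence is immaterial for the applications. The digit at position `i`
(coefficient of `2^i`) is Green's digit `i + 1`, whence the denominators `2^{i+1}`.)
[cite: Green2012, §3 Proposition 2] -/
theorem exists_sparse_dyadic_of_le_abs_cubeFourierCoeff {n : ℕ} (f : ℕ → ℝ)
    (hf : ∀ m, |f m| ≤ 1) (S : Finset (Fin n)) {δ : ℝ} (hδ : 0 < δ)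
    (hbig : δ ≤ |LowDegree.cubeFourierCoeff
      (fun x : Fin n → Bool => f (bitsToNat (List.ofFn x))) S|)
    {R : ℕ} (hR1 : 1 ≤ R) (hR : 4 * (S.card : ℝ) * (n + 1) ≤ δ * R) :
    ∃ r : Fin n → ℤ, (∀ i, i ∉ S → r i = 0) ∧ (∀ i, |r i| < R) ∧
      δ / (2 * (2 * (R : ℝ)) ^ S.card) * 2 ^ n ≤
        ‖∑ m ∈ range (2 ^ n), (f m : ℂ) *
          𝐞 ((m : ℝ) * ∑ i ∈ S, (r i : ℝ) / (2 : ℝ) ^ ((i : ℕ) + 1))‖ := by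
  classical
  -- the square wave and its Fejér smoothing, as local functions
  let ψ : ℕ → ℕ → ℝ := fun M y => if y % M < M / 2 then (1 : ℝ) else -1
  have hψ : ∀ M y, ψ M y = if y % M < M / 2 then (1 : ℝ) else -1 := fun M y => rfl
  let Φ : ℕ → ℕ → ℕ → ℝ := fun H M y =>
    (∑ z ∈ range M, fejerKernel H ((z : ℝ) / M) * ψ M (y + z)) / M
  have hΦ : ∀ H M y, Φ H M y = (∑ z ∈ range M, fejerKernel H ((z : ℝ) / M) * ψ M (y + z)) / M :=
    fun H M y => rfl
  have hNr : (0 : ℝ) < (2 : ℝ) ^ n := by positivity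
  have hRr : (0 : ℝ) < R := by exact_mod_cast hR1
  -- per-digit data
  have hdata := fun i : Fin n => digit_smoothing_data ψ hψ Φ hΦ (n := n) i hR1
  choose T v hT hv herr hexp using hdata
  set χ : Fin n → ℕ → ℝ := fun i m => ψ (2 ^ ((i : ℕ) + 1)) m with hχdef
  -- Step 1: `δ 2^n ≤ |W|`
  set W : ℝ := ∑ m ∈ range (2 ^ n), f m * ∏ i ∈ S, χ i m with hWdef
  have hW : δ * 2 ^ n ≤ |W| := by
    have h1 : LowDegree.cubeFourierCoeff (fun x : Fin n → Bool => f (bitsToNat (List.ofFn x))) S =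
        W / 2 ^ n := by
      unfold LowDegree.cubeFourierCoeff
      rw [sum_cube_walsh_eq_sum_range ψ hψ]
    rw [h1, abs_div, abs_of_pos hNr, le_div_iff₀ hNr] at hbig
    exact hbig
  -- Step 2: `|W − V| ≤ δ 2^n / 2`
  set V : ℝ := ∑ m ∈ range (2 ^ n), f m * ∏ i ∈ S, T i m with hVdef
  have hWV : |W - V| ≤ δ * 2 ^ n / 2 := by
    rw [hWdef, hVdef, ← Finset.sum_sub_distrib]
    calc |∑ m ∈ range (2 ^ n), (f m * ∏ i ∈ S, χ i m - f m * ∏ i ∈ S, T i m)|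
        ≤ ∑ m ∈ range (2 ^ n), |f m * ∏ i ∈ S, χ i m - f m * ∏ i ∈ S, T i m| :=
          abs_sum_le_sum_abs _ _
      _ ≤ ∑ m ∈ range (2 ^ n), ∑ i ∈ S, |χ i m - T i m| := by
          refine Finset.sum_le_sum fun m _ => ?_
          rw [← mul_sub, abs_mul]
          calc |f m| * |∏ i ∈ S, χ i m - ∏ i ∈ S, T i m| ≤ 1 * ∑ i ∈ S, |χ i m - T i m| :=
                mul_le_mul (hf m) (abs_prod_sub_prod_le S _ _ (fun i _ => abs_sq_le ψ hψ _ _)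
                  (fun i _ => hT i m)) (abs_nonneg _) zero_le_one
            _ = _ := one_mul _
      _ = ∑ i ∈ S, ∑ m ∈ range (2 ^ n), |χ i m - T i m| := Finset.sum_comm
      _ ≤ ∑ _i ∈ S, (2 : ℝ) ^ n * (2 * (n + 1) / R) := Finset.sum_le_sum fun i _ => herr i
      _ = S.card * ((2 : ℝ) ^ n * (2 * (n + 1) / R)) := by rw [Finset.sum_const, nsmul_eq_mul]
      _ ≤ δ * 2 ^ n / 2 := by
          have h1 : (S.card : ℝ) * (2 * (n + 1) / R) ≤ δ / 2 := by
            rw [mul_div_assoc', div_le_iff₀ hRr]; linarith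
          have h2 : (S.card : ℝ) * ((2 : ℝ) ^ n * (2 * (n + 1) / R)) =
              2 ^ n * ((S.card : ℝ) * (2 * (n + 1) / R)) := by ring
          rw [h2]
          have := mul_le_mul_of_nonneg_left h1 hNr.le
          linarith
  have hV : δ * 2 ^ n / 2 ≤ |V| := by
    have := abs_sub_abs_le_abs_sub W V
    linarith
  -- Step 3: expand `V`
  set J : Finset ℤ := Ioo (-(R : ℤ)) R with hJdef
  set t : Fin n → Finset ℤ := fun i => if i ∈ S then J else {0} with htdef
  set w : Fin n → ℤ → ℂ := fun i h => if i ∈ S then v i h else 1 with hwdef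
  set θ : (Fin n → ℤ) → ℝ := fun r => ∑ i ∈ S, (r i : ℝ) / (2 : ℝ) ^ ((i : ℕ) + 1) with hθdef
  set Sf : ℝ → ℂ := fun α => ∑ m ∈ range (2 ^ n), (f m : ℂ) * 𝐞 ((m : ℝ) * α) with hSfdef
  have hmem_t : ∀ r ∈ Fintype.piFinset t, ∀ i, i ∉ S → r i = 0 := by
    intro r hr i hi
    have := Fintype.mem_piFinset.mp hr i
    rw [htdef] at this
    simp only [hi, if_false, Finset.mem_singleton] at this
    exact this
  -- the product of the digit polynomials
  have hprod : ∀ m : ℕ, (∏ i ∈ S, (T i m : ℂ)) =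
      ∑ r ∈ Fintype.piFinset t, (∏ i, w i (r i)) * 𝐞 ((m : ℝ) * θ r) := by
    intro m
    have h1 : (∏ i ∈ S, (T i m : ℂ)) = ∏ i, ∑ h ∈ t i, w i h * 𝐞 ((m : ℝ) * ((h : ℝ) / (2 : ℝ) ^ ((i : ℕ) + 1))) := by
      rw [← Finset.univ_inter S, ← Finset.prod_ite_mem]
      refine Finset.prod_congr rfl fun i _ => ?_
      by_cases hi : i ∈ S
      · rw [if_pos hi, hexp i m]
        simp only [htdef, hwdef, hi, if_true]
      · rw [if_neg hi]
        simp only [htdef, hwdef, hi, if_false, Finset.sum_singleton]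
        simp
    rw [h1, Finset.prod_univ_sum]
    refine Finset.sum_congr rfl fun r hr => ?_
    -- `∑_i r_i/2^{i+1} = ∑_{i ∈ S} r_i/2^{i+1}` since `r_i = 0` off `S`
    have hsumS : ∑ i : Fin n, (m : ℝ) * ((r i : ℝ) / (2 : ℝ) ^ ((i : ℕ) + 1)) = (m : ℝ) * θ r := by
      rw [hθdef]
      simp only
      rw [Finset.mul_sum]
      refine (Finset.sum_subset (Finset.subset_univ S) fun i _ hi => ?_).symm
      rw [hmem_t r hr i hi]; simp
    rw [Finset.prod_mul_distrib, ← Literature.NumberTheory.Sieve.MoebiusWalsh.coe_fourierChar_sum, hsumS]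
  have hVexp : (V : ℂ) = ∑ r ∈ Fintype.piFinset t, (∏ i, w i (r i)) * Sf (θ r) := by
    rw [hVdef]
    push_cast
    simp_rw [hprod, Finset.mul_sum]
    rw [Finset.sum_comm]
    refine Finset.sum_congr rfl fun r _ => ?_
    rw [hSfdef]
    simp only
    rw [Finset.mul_sum]
    refine Finset.sum_congr rfl fun m _ => ?_
    ring
  -- Step 4: sizes
  have hw1 : ∀ r : Fin n → ℤ, ‖∏ i, w i (r i)‖ ≤ 1 := by
    intro r
    rw [norm_prod]
    refine Finset.prod_le_one (fun i _ => norm_nonneg _) fun i _ => ?_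
    simp only [hwdef]
    split_ifs
    · exact hv i (r i)
    · simp
  have hJcard : (J.card : ℝ) ≤ 2 * R := by
    rw [hJdef, Int.card_Ioo]
    have : ((R : ℤ) - -(R : ℤ) - 1).toNat ≤ 2 * R := by omega
    exact_mod_cast this
  have hJne : J.Nonempty := ⟨0, by rw [hJdef, Finset.mem_Ioo]; constructor <;> omega⟩
  have htne : ∀ i, (t i).Nonempty := by
    intro i; simp only [htdef]; split_ifs
    · exact hJne
    · exact Finset.singleton_nonempty 0
  have hpine : (Fintype.piFinset t).Nonempty := Fintype.piFinset_nonempty.mpr htne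
  set P : ℕ := (Fintype.piFinset t).card with hPdef
  have hP0 : (0 : ℝ) < P := by exact_mod_cast hpine.card_pos
  have hPle : (P : ℝ) ≤ (2 * (R : ℝ)) ^ S.card := by
    rw [hPdef, Fintype.card_piFinset]
    have h1 : (∏ i, (t i).card) = ∏ i ∈ S, J.card := by
      rw [← Finset.univ_inter S, ← Finset.prod_ite_mem]
      refine Finset.prod_congr rfl fun i _ => ?_
      simp only [htdef]
      split_ifs <;> simp
    rw [h1, Finset.prod_const]
    push_cast
    exact pow_le_pow_left₀ (by positivity) hJcard _
  -- `‖V‖ ≤ ∑_r ‖Sf(θ_r)‖`, so some `r` has `‖Sf(θ_r)‖ ≥ ‖V‖/P`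
  have hsum : ∑ _r ∈ Fintype.piFinset t, |V| / P ≤ ∑ r ∈ Fintype.piFinset t, ‖Sf (θ r)‖ := by
    rw [Finset.sum_const, nsmul_eq_mul, ← hPdef, mul_div_cancel₀ _ hP0.ne']
    calc |V| = ‖(V : ℂ)‖ := by rw [Complex.norm_real, Real.norm_eq_abs]
      _ = ‖∑ r ∈ Fintype.piFinset t, (∏ i, w i (r i)) * Sf (θ r)‖ := by rw [hVexp]
      _ ≤ ∑ r ∈ Fintype.piFinset t, ‖(∏ i, w i (r i)) * Sf (θ r)‖ := norm_sum_le _ _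
      _ ≤ ∑ r ∈ Fintype.piFinset t, ‖Sf (θ r)‖ := by
          refine Finset.sum_le_sum fun r _ => ?_
          rw [norm_mul]
          calc ‖∏ i, w i (r i)‖ * ‖Sf (θ r)‖ ≤ 1 * ‖Sf (θ r)‖ :=
                mul_le_mul_of_nonneg_right (hw1 r) (norm_nonneg _)
            _ = ‖Sf (θ r)‖ := one_mul _
  obtain ⟨r, hr, hrle⟩ := Finset.exists_le_of_sum_le hpine hsum
  -- Step 5: the output
  refine ⟨r, hmem_t r hr, fun i => ?_, ?_⟩
  · have := Fintype.mem_piFinset.mp hr i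
    simp only [htdef] at this
    split_ifs at this with hi
    · rw [hJdef, Finset.mem_Ioo] at this
      exact abs_lt.mpr ⟨this.1, this.2⟩
    · rw [Finset.mem_singleton] at this
      rw [this, abs_zero]; exact_mod_cast hR1
  · have hθ : θ r = ∑ i ∈ S, (r i : ℝ) / (2 : ℝ) ^ ((i : ℕ) + 1) := rfl
    rw [← hθ]
    change δ / (2 * (2 * (R : ℝ)) ^ S.card) * 2 ^ n ≤ ‖Sf (θ r)‖
    refine le_trans ?_ hrle
    -- `δ/(2(2R)^k) 2^n ≤ (δ 2^n/2)/P ≤ |V|/P`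
    have hpow : (0 : ℝ) < (2 * (R : ℝ)) ^ S.card := by positivity
    calc δ / (2 * (2 * (R : ℝ)) ^ S.card) * 2 ^ n = (δ * 2 ^ n / 2) / (2 * (R : ℝ)) ^ S.card := by
          field_simp
      _ ≤ (δ * 2 ^ n / 2) / P := div_le_div_of_nonneg_left (by positivity) hP0 hPle
      _ ≤ |V| / P := div_le_div_of_nonneg_right hV hP0.le

end WalshDyadic

end Literature.Computability.Complexity
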